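import Summits.QuantumFields.YangMills.Theorems.BalabanUVNodesN15KingModelGaussianIntegrationByParts
import Summits.QuantumFields.YangMills.Theorems.BalabanUVNodesN15KingModelGaussianLawIdentification
import Literature.Combinatorics.Enumerative.HafnianGeneratingFunction

/-!
# BalabanUVNodes ∕ N15 — THE KING-MODEL RUNG (PART Ͱ-b): ISSERLIS' THEOREM — THE MIXED MOMENTS OF THE GAUSSIAN LAW `ρ_A dx` ARE THE HAFNIANS OF THE
# COVARIANCE GRAM MATRIX: `∫∏_{i∈S}⟨J_i,x⟩ρ_A(x)dx = Haf((⟨J_u,A⁻¹J_v⟩)_{u,v∈S})` (WICK's THEOREM TO ALL ORDERS); odd moments vanish;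
# `∫⟨J,x⟩^{2k}ρ_A = (2k−1)!!·⟨J,A⁻¹J⟩^k`; the same for the MEASURE `ρ_A dx` and for the tree's `gaussianFieldOfKernel (A⁻¹)`
# (Track A, DAG node N15 = NE2; FAN-OUT v1.1 §N15 s3 «KING-MODEL RUNG»; uses part Ͱ-a (the recursion), Ϝ-u (identification) and the tree's hafnian library
# `Literature/Combinatorics/Enumerative/Hafnian{,Expansion,GeneratingFunction}`; count-neutral)

HONEST FRAMING.  Count-neutral (cell `pub-ymgap`, seat `pub-ymgap-dag-n15-e` g34; `--supports stmt-QuantumFields-27366 --as helper` = K3⁸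
`SpineGivenEndpointR13SepCoPHV`).  Folklore probability: ISSERLIS (1918) ∕ WICK (1950) — for a centred Gaussian vector the expectation of a product of linear
forms is the sum over the perfect matchings of the index set of the products of the matched covariances, i.e. the HAFNIAN of the covariance Gram matrix
(Caianiello's `[1 ⋯ 2n]`; Barvinok §2.1).  Here for the DENSITY-defined law `ρ_A(x)dx = e^{−½⟨x,Ax⟩}dx∕𝒩(A)` of a symmetric coercive precision `A` on `ℝ^ι`
— the shape of every measure of [King1986] (C. King, Commun. Math. Phys. **102** (1986) 649–677) (2.6) p.652 — stated in the TREE'S VOCABULARY: the tree's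
`Literature.Combinatorics.Enumerative.hafnian` (sum over fixed-point-free involutions) of the submatrix `subMat G S` of the Gram matrix
`G = (⟨J_u,A⁻¹J_v⟩)_{u,v}`.  PROOF: strong induction on `S` — peel `s ∈ S`, apply part Ͱ-a's Gaussian integration by parts
`∫⟨J_s,x⟩∏_{S∖s}⟨J_i,x⟩ρ_A = Σ_{v∈S∖s}G_{sv}∫∏_{S∖{s,v}}⟨J_i,x⟩ρ_A`, and recognise Barvinok's row expansion (4.3.1) of the hafnian
(`HafnianGeneratingFunction.hafnian_subMat_eq_sum`, already in the tree) — the two recursions coincide, the bases agree (`∫ρ_A = 1 = Haf(∅)`).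
The tree's `HafnianGeneratingFunction` proves the FORMAL identity `∂^{2N}e^{½αᵗAα}|₀ = Haf(A_S)` in `MvPolynomial`.  NEAREST PRIOR ART (v1.1 ERRATUM,
correcting the v1.0 sentence «the ANALYTIC statement for an actual measure … new to the tree», which was WRONG): ALL-ORDERS WICK ∕ ISSERLIS WAS ALREADY
IN THE TREE in three pairing currencies — `Literature/Probability/Distributions/GaussianWickTheorem.lean` (`GaussianWick.integral_mul_prod_eq_sum`, the
Gaussian integration by parts for every centred Mathlib-`IsGaussianProcess`; `integral_prod_eq_pairingSum` with `Literature.Probability.LatticeModels.pairingSum`;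
the `_of_ibp` engine for densities; `MultivariateGaussianWick` for Mathlib's `multivariateGaussian`), `Balaban1983to89/HiggsFluctMeasureWickSum` ∕
`…WickPairingSum` (`wickSum`; `integral_prod_eq_wickSum`, `integral_prod_eval_eq_wickSum`, the literal `pairPartitions` form of Janson (1.2)) and
`…HiggsFluctMeasureWickExponentialModels` (`integral_prod_linF_eq_wickSum`).  What THIS file adds is (a) the FOURTH currency, the combinatorics shelf's
`hafnian` (fixed-point-free involutions), bridged to the other three BY NAME in `Literature/Combinatorics/Enumerative/HafnianWickSum.lean`
(`wickSum_eq_hafnian_subMat`, `pairingSum_eq_hafnian`), (b) an independent proof for the density-defined law `ρ_A dx` by part Ͱ-a's one-parameter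
differentiation + completing the square, (c) arbitrary finite families `S : Finset W` with repetitions (parts Ϝ-s∕Ϝ-t stopped at order four for this law).
NOT a node discharge (N15 is booked through n15-a's knit, untouched here); nothing Bałaban ∕ continuum-Yang–Mills ∕ `ℝ⁴` ∕ OS ∕
mass-gap ∕ Clay.  0 `sorry`, 0 def; standard axioms.

WHAT THIS FILE PROVES (kernel).  §1 `isSymm_gram`, ★★★ **`integral_prod_dot_gaussDensity_eq_hafnian`** (every `S : Finset W`), ★★★ `integral_prod_univ_dot_gaussDensity_eq_hafnian`
(`S = univ`: the hafnian of the full Gram matrix); §2 `hafnian_eq_zero_of_odd_card` (no perfect matching of an odd set), ★★ `integral_prod_dot_gaussDensity_eq_zero_of_odd`,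
`hafnian_of_const` (`Haf` of the constant `2k × 2k` matrix `q` is `(2k−1)!!·q^k`, the tree's `card_perfectMatchings`), ★★ **`integral_dot_pow_even_gaussDensity`**
(`∫⟨J,x⟩^{2k}ρ_A = (2k−1)!!·⟨J,A⁻¹J⟩^k`), `integral_dot_pow_odd_gaussDensity`, `integral_dot_pow_six_gaussDensity` (`= 15Q³`, check); §3 COORDINATES:
★★ `integral_prod_eval_gaussDensity_eq_hafnian` (`∫∏_{i∈S}x_{p(i)}ρ_A = Haf(((A⁻¹)_{p(u)p(v)})_{u,v∈S})`); §4 MEASURE FORMS: ★★ `integral_prod_dot_gaussLaw_eq_hafnian`,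
`integral_prod_eval_gaussLaw_eq_hafnian`, ★★★ **`integral_prod_eval_gaussianFieldOfKernel_inv_eq_hafnian`** (Wick to all orders for the tree's Kolmogorov-built
`gaussianFieldOfKernel (A⁻¹)` through part Ϝ-u's identification).

HONEST SCOPE.  Finite-dimensional centred Gaussians with a coercive precision only (for `gaussianFieldOfKernel K` this means: finite index set and POSITIVE-DEFINITE
`K = A⁻¹`; the semidefinite ∕ infinite-index cases are not treated); folklore.  N15 untouched; counts unmoved.  Locators (use): [King1986] (2.6) p.652, (2.15) p.653,
Thm 2.1 (2.22)–(2.23) p.654.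
-/

noncomputable section

open scoped BigOperators
open Finset Matrix Filter Topology MeasureTheory

namespace Summit.QuantumFields.YangMills.BalabanUVNodes.N15KingModelRung.FreeField

open Literature.MathematicalPhysics.QuantumFieldTheory (gaussianFieldOfKernel)
open Literature.MathematicalPhysics.QuantumFieldTheory.Balaban1983to89.QGQInverse (Coercive isUnit_of_coercive)
open Literature.Combinatorics.Enumerative (hafnian perfectMatchings mem_perfectMatchings two_mul_card_filter_lt_add_card_fixed
  card_filter_lt_of_mem_perfectMatchings card_perfectMatchings)
open Literature.Combinatorics.Enumerative.HafnianGeneratingFunction (subMat hafnian_subMat_eq_sum hafnian_subMat_empty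
  hafnian_submatrix_equiv)

variable {ι : Type*} [Fintype ι] [DecidableEq ι]

/-! ## §1 Isserlis' theorem: `∫∏_{i∈S}⟨J_i,x⟩ρ_A = Haf(G_S)` -/

section Isserlis

variable {A : Matrix ι ι ℝ} {δ : ℝ} {W : Type*} [DecidableEq W] [LinearOrder W]

omit [LinearOrder W] [DecidableEq W] in
/-- The covariance Gram matrix `G = (⟨J_u,A⁻¹J_v⟩)_{u,v}` of a family of linear forms under `ρ_A dx` is symmetric (`A` symmetric). [folklore] -/
theorem isSymm_gram (hsymm : Aᵀ = A) (J : W → ι → ℝ) : (Matrix.of fun u v : W => J u ⬝ᵥ (A⁻¹ *ᵥ J v)).IsSymm :=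
  Matrix.IsSymm.ext fun u v => by
    simp only [Matrix.of_apply]
    exact dot_mulVec_comm_of_transpose_eq (transpose_inv_of_transpose_eq hsymm) _ _

/-- ★★★ **ISSERLIS' THEOREM (WICK's THEOREM TO ALL ORDERS)**: for a symmetric coercive precision `A`, every family of linear forms `J : W → ℝ^ι` and every
finite `S ⊆ W`, `∫∏_{i∈S}⟨J_i,x⟩ρ_A(x)dx = Haf(G_S)`, `G = (⟨J_u,A⁻¹J_v⟩)_{u,v}` — the sum over the perfect matchings of `S` of the products of the matched
covariances (zero when `|S|` is odd).  Strong induction on `S`: part Ͱ-a's Gaussian integration by parts is Barvinok's row expansion of the hafnian.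
[cite: King1986, (2.6) p.652, (2.15) p.653] -/
theorem integral_prod_dot_gaussDensity_eq_hafnian (hδ : 0 < δ) (hA : Coercive A δ) (hsymm : Aᵀ = A) (J : W → ι → ℝ)
    (S : Finset W) :
    ∫ x : ι → ℝ, (∏ i ∈ S, J i ⬝ᵥ x) * gaussDensity A x
      = hafnian (subMat (Matrix.of fun u v : W => J u ⬝ᵥ (A⁻¹ *ᵥ J v)) S) := by
  induction S using Finset.strongInduction with
  | H S ih =>
    rcases S.eq_empty_or_nonempty with hS | ⟨s, hs⟩
    · subst hS
      rw [hafnian_subMat_empty]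
      simp only [Finset.prod_empty, one_mul]
      exact integral_gaussDensity_eq_one hδ hA
    · rw [hafnian_subMat_eq_sum _ (isSymm_gram hsymm J) hs]
      have h1 : (fun x : ι → ℝ => (∏ i ∈ S, J i ⬝ᵥ x) * gaussDensity A x)
          = fun x => (J s ⬝ᵥ x) * (∏ i ∈ S.erase s, J i ⬝ᵥ x) * gaussDensity A x := by
        funext x
        rw [← Finset.mul_prod_erase S (fun i => J i ⬝ᵥ x) hs]
      rw [h1, integral_dot_mul_prod_gaussDensity hδ hA hsymm (J s) J (S.erase s)]
      refine Finset.sum_congr rfl fun v hv => ?_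
      rw [Matrix.of_apply, ih _ ((Finset.erase_subset v (S.erase s)).trans_ssubset (Finset.erase_ssubset hs))]

/-- ★★★ **The full family**: for a finite index type `W`, `∫∏_{i∈W}⟨J_i,x⟩ρ_A(x)dx = Haf(G)`, `G = (⟨J_u,A⁻¹J_v⟩)_{u,v∈W}`.
[cite: King1986, (2.6) p.652, (2.15) p.653] -/
theorem integral_prod_univ_dot_gaussDensity_eq_hafnian [Fintype W] (hδ : 0 < δ) (hA : Coercive A δ) (hsymm : Aᵀ = A)
    (J : W → ι → ℝ) :
    ∫ x : ι → ℝ, (∏ i, J i ⬝ᵥ x) * gaussDensity A x = hafnian (Matrix.of fun u v : W => J u ⬝ᵥ (A⁻¹ *ᵥ J v)) := by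
  rw [integral_prod_dot_gaussDensity_eq_hafnian hδ hA hsymm J Finset.univ]
  exact hafnian_submatrix_equiv (Equiv.subtypeUnivEquiv Finset.mem_univ) (fun _ _ h => h) _

end Isserlis

/-! ## §2 Parity, and the even moments of one linear form -/

section Parity

variable {A : Matrix ι ι ℝ} {δ : ℝ} {W : Type*} [DecidableEq W] [LinearOrder W]

omit [Fintype ι] [DecidableEq ι] in
/-- A set of odd size has no perfect matching, so every hafnian on it vanishes (`2·#pairs + #loops = |V|` with no loops). [folklore] -/
theorem hafnian_eq_zero_of_odd_card {V : Type*} [Fintype V] [DecidableEq V] [LinearOrder V] {R : Type*} [CommSemiring R]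
    (hodd : Odd (Fintype.card V)) (B : Matrix V V R) : hafnian B = 0 := by
  unfold hafnian
  refine Finset.sum_eq_zero fun τ hτ => ?_
  exfalso
  have hτ' := mem_perfectMatchings.mp hτ
  have h := two_mul_card_filter_lt_add_card_fixed hτ'.1
  rw [Finset.card_eq_zero.mpr (Finset.filter_eq_empty_iff.mpr fun v _ => hτ'.2 v), add_zero] at h
  obtain ⟨c, hc⟩ : ∃ c : ℕ, 2 * c = Fintype.card V := ⟨_, h⟩
  exact (Nat.not_even_iff_odd.mpr hodd) ⟨c, by omega⟩

/-- ★★ **Odd mixed moments vanish**: `|S|` odd ⇒ `∫∏_{i∈S}⟨J_i,x⟩ρ_A = 0`. [folklore] -/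
theorem integral_prod_dot_gaussDensity_eq_zero_of_odd (hδ : 0 < δ) (hA : Coercive A δ) (hsymm : Aᵀ = A) (J : W → ι → ℝ)
    {S : Finset W} (hodd : Odd S.card) :
    ∫ x : ι → ℝ, (∏ i ∈ S, J i ⬝ᵥ x) * gaussDensity A x = 0 := by
  rw [integral_prod_dot_gaussDensity_eq_hafnian hδ hA hsymm J S]
  exact hafnian_eq_zero_of_odd_card (by rwa [Fintype.card_coe]) _

omit [Fintype ι] [DecidableEq ι] in
/-- The hafnian of the constant `2k × 2k` matrix `q` is `(2k−1)!!·q^k` (every perfect matching has `k` pairs; there are `(2k−1)!!` of them — the tree's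
`card_perfectMatchings`). [folklore] -/
theorem hafnian_of_const {V : Type*} [Fintype V] [DecidableEq V] [LinearOrder V] (q : ℝ) {k : ℕ} (hV : Fintype.card V = 2 * k) :
    hafnian (Matrix.of fun _ _ : V => q) = (Nat.doubleFactorial (2 * k - 1) : ℝ) * q ^ k := by
  unfold hafnian
  simp only [Matrix.of_apply, Finset.prod_const]
  rw [Finset.sum_congr rfl fun τ hτ => by rw [card_filter_lt_of_mem_perfectMatchings hτ, hV, Nat.mul_div_cancel_left _ two_pos],
    Finset.sum_const, card_perfectMatchings hV, nsmul_eq_mul]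

/-- ★★ **THE EVEN MOMENTS OF ONE LINEAR FORM**: `∫⟨J,x⟩^{2k}ρ_A(x)dx = (2k−1)!!·⟨J,A⁻¹J⟩^k` (Isserlis with all `2k` forms equal: every perfect matching of
`Fin 2k` contributes `Q^k`). [folklore] -/
theorem integral_dot_pow_even_gaussDensity (hδ : 0 < δ) (hA : Coercive A δ) (hsymm : Aᵀ = A) (J : ι → ℝ) (k : ℕ) :
    ∫ x : ι → ℝ, (J ⬝ᵥ x) ^ (2 * k) * gaussDensity A x
      = (Nat.doubleFactorial (2 * k - 1) : ℝ) * (J ⬝ᵥ (A⁻¹ *ᵥ J)) ^ k := by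
  have h := integral_prod_univ_dot_gaussDensity_eq_hafnian (W := Fin (2 * k)) hδ hA hsymm (fun _ => J)
  simp only [Finset.prod_const, Finset.card_univ, Fintype.card_fin] at h
  rw [h]
  exact hafnian_of_const _ (Fintype.card_fin _)

/-- The odd moments of one linear form vanish: `∫⟨J,x⟩^{2k+1}ρ_A(x)dx = 0`. [folklore] -/
theorem integral_dot_pow_odd_gaussDensity (hδ : 0 < δ) (hA : Coercive A δ) (hsymm : Aᵀ = A) (J : ι → ℝ) (k : ℕ) :
    ∫ x : ι → ℝ, (J ⬝ᵥ x) ^ (2 * k + 1) * gaussDensity A x = 0 := by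
  have h := integral_prod_dot_gaussDensity_eq_zero_of_odd (W := Fin (2 * k + 1)) hδ hA hsymm (fun _ => J)
    (S := Finset.univ) (by rw [Finset.card_univ, Fintype.card_fin]; exact odd_two_mul_add_one k)
  simp only [Finset.prod_const, Finset.card_univ, Fintype.card_fin] at h
  exact h

/-- Check (order six, beyond parts Ϝ-s∕Ϝ-t): `∫⟨J,x⟩⁶ρ_A(x)dx = 15·⟨J,A⁻¹J⟩³`. [folklore] -/
theorem integral_dot_pow_six_gaussDensity (hδ : 0 < δ) (hA : Coercive A δ) (hsymm : Aᵀ = A) (J : ι → ℝ) :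
    ∫ x : ι → ℝ, (J ⬝ᵥ x) ^ 6 * gaussDensity A x = 15 * (J ⬝ᵥ (A⁻¹ *ᵥ J)) ^ 3 := by
  have h := integral_dot_pow_even_gaussDensity hδ hA hsymm J 3
  norm_num [Nat.doubleFactorial] at h
  exact h

end Parity

/-! ## §3 Coordinates: `∫∏_{i∈S}x_{p(i)}ρ_A = Haf(((A⁻¹)_{p(u)p(v)})_{u,v∈S})` -/

section Coordinates

variable {A : Matrix ι ι ℝ} {δ : ℝ} {W : Type*} [DecidableEq W] [LinearOrder W]

/-- ★★ **COORDINATE MOMENTS**: for points `p : W → ι`, `∫∏_{i∈S}x_{p(i)}ρ_A(x)dx = Haf(((A⁻¹)_{p(u),p(v)})_{u,v∈S})` (repeated points allowed).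
[cite: King1986, (2.6) p.652, (2.23) p.654] -/
theorem integral_prod_eval_gaussDensity_eq_hafnian (hδ : 0 < δ) (hA : Coercive A δ) (hsymm : Aᵀ = A) (p : W → ι) (S : Finset W) :
    ∫ x : ι → ℝ, (∏ i ∈ S, x (p i)) * gaussDensity A x = hafnian (subMat (Matrix.of fun u v : W => A⁻¹ (p u) (p v)) S) := by
  have h := integral_prod_dot_gaussDensity_eq_hafnian hδ hA hsymm (fun i => Pi.single (p i) (1 : ℝ)) S
  simp only [single_one_dotProduct, Matrix.mulVec_single_one] at h
  exact h

/-- The full family of coordinates: `∫∏_{i∈W}x_{p(i)}ρ_A(x)dx = Haf(((A⁻¹)_{p(u),p(v)})_{u,v∈W})`. [cite: King1986, (2.6) p.652, (2.23) p.654] -/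
theorem integral_prod_univ_eval_gaussDensity_eq_hafnian [Fintype W] (hδ : 0 < δ) (hA : Coercive A δ) (hsymm : Aᵀ = A) (p : W → ι) :
    ∫ x : ι → ℝ, (∏ i, x (p i)) * gaussDensity A x = hafnian (Matrix.of fun u v : W => A⁻¹ (p u) (p v)) := by
  have h := integral_prod_univ_dot_gaussDensity_eq_hafnian hδ hA hsymm (fun i => Pi.single (p i) (1 : ℝ))
  simp only [single_one_dotProduct, Matrix.mulVec_single_one] at h
  exact h

end Coordinates

/-! ## §4 Measure forms: the law `ρ_A dx` (part Ϝ-u's `gaussLaw`) and the tree's `gaussianFieldOfKernel (A⁻¹)` -/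

section MeasureForms

variable {A : Matrix ι ι ℝ} {δ : ℝ} {W : Type*} [DecidableEq W] [LinearOrder W]

/-- ★★ **ISSERLIS FOR THE MEASURE `ρ_A dx`**: `∫∏_{i∈S}⟨J_i,·⟩ d(ρ_A dx) = Haf(G_S)`. [cite: King1986, (2.6) p.652, (2.15) p.653] -/
theorem integral_prod_dot_gaussLaw_eq_hafnian (hδ : 0 < δ) (hA : Coercive A δ) (hsymm : Aᵀ = A) (J : W → ι → ℝ) (S : Finset W) :
    ∫ x, (∏ i ∈ S, J i ⬝ᵥ x) ∂gaussLaw A = hafnian (subMat (Matrix.of fun u v : W => J u ⬝ᵥ (A⁻¹ *ᵥ J v)) S) := by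
  rw [integral_gaussLaw_real hδ hA, integral_prod_dot_gaussDensity_eq_hafnian hδ hA hsymm J S]

/-- Coordinate moments of the measure `ρ_A dx`: `∫∏_{i∈S}x_{p(i)} d(ρ_A dx) = Haf(((A⁻¹)_{p(u)p(v)})_{u,v∈S})`. [cite: King1986, (2.6) p.652, (2.23) p.654] -/
theorem integral_prod_eval_gaussLaw_eq_hafnian (hδ : 0 < δ) (hA : Coercive A δ) (hsymm : Aᵀ = A) (p : W → ι) (S : Finset W) :
    ∫ x, (∏ i ∈ S, x (p i)) ∂gaussLaw A = hafnian (subMat (Matrix.of fun u v : W => A⁻¹ (p u) (p v)) S) := by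
  rw [integral_gaussLaw_real hδ hA, integral_prod_eval_gaussDensity_eq_hafnian hδ hA hsymm p S]

/-- ★★★ **WICK's THEOREM TO ALL ORDERS FOR THE TREE's `gaussianFieldOfKernel (A⁻¹)`** (finite index set, positive-definite kernel `A⁻¹` given through its
symmetric coercive inverse `A`): `∫∏_{i∈S}φ(p(i)) d(gaussianFieldOfKernel A⁻¹) = Haf(((A⁻¹)_{p(u)p(v)})_{u,v∈S})` — by part Ϝ-u's identification
`ρ_A dx = gaussianFieldOfKernel (A⁻¹)`. [cite: King1986, (2.6) p.652, (2.23) p.654] -/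
theorem integral_prod_eval_gaussianFieldOfKernel_inv_eq_hafnian (hδ : 0 < δ) (hA : Coercive A δ) (hsymm : Aᵀ = A) (p : W → ι)
    (S : Finset W) :
    ∫ φ, (∏ i ∈ S, φ (p i)) ∂gaussianFieldOfKernel (fun i j : ι => A⁻¹ i j)
      = hafnian (subMat (Matrix.of fun u v : W => A⁻¹ (p u) (p v)) S) := by
  rw [← gaussLaw_eq_gaussianFieldOfKernel hδ hA hsymm, integral_prod_eval_gaussLaw_eq_hafnian hδ hA hsymm p S]

/-- Linear functionals of the tree's `gaussianFieldOfKernel (A⁻¹)`: `∫∏_{i∈S}⟨J_i,φ⟩ d(gaussianFieldOfKernel A⁻¹) = Haf((⟨J_u,A⁻¹J_v⟩)_{u,v∈S})`.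
[cite: King1986, (2.6) p.652, (2.15) p.653] -/
theorem integral_prod_dot_gaussianFieldOfKernel_inv_eq_hafnian (hδ : 0 < δ) (hA : Coercive A δ) (hsymm : Aᵀ = A) (J : W → ι → ℝ)
    (S : Finset W) :
    ∫ φ, (∏ i ∈ S, J i ⬝ᵥ φ) ∂gaussianFieldOfKernel (fun i j : ι => A⁻¹ i j)
      = hafnian (subMat (Matrix.of fun u v : W => J u ⬝ᵥ (A⁻¹ *ᵥ J v)) S) := by
  rw [← gaussLaw_eq_gaussianFieldOfKernel hδ hA hsymm, integral_prod_dot_gaussLaw_eq_hafnian hδ hA hsymm J S]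

end MeasureForms

end Summit.QuantumFields.YangMills.BalabanUVNodes.N15KingModelRung.FreeField
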